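import Mathlib.Analysis.SpecialFunctions.ExpDeriv
import Literature.Analysis.ODE.OneSidedComparison
import HarnessLib

/-!
# Fluid computer blueprint — drain conversion: the SHARP Lyapunov function

HONEST FRAMING: low prior, high value-of-information experiment on Tao's machine paradigm; NOT a
claim that NS blows up. Elementary planar ODE estimates; nothing is asserted about any fluid
equation or about the threshold gate itself.

## Why

`DrainConversionTime.lean` proves pair-energy decay for `a' = -ω·d + p`, `d' = ω·a - g·d + q`
(damping band `γ₀ω ≤ g ≤ γ₁ω`) at the angle-rate `γ₀/(3(1 + γ₁²))` with the Lyapunov function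
`a² + d² - βad`, `β = γ₀/(1 + γ₁²)`. That rate is 6–15× below the truth and makes the a-priori
transfer budget of the threshold gate hopeless (80 % conversion would need `Θ ≳ 40 rad` against the
observed `2–4.5 rad`, kit j049182). The cure is an identity: for CONSTANT damping ratio `γ` and no
forcing, `V = a² + d² - γ·ad` satisfies `V' = -γ·ω·V` EXACTLY (and `V ≍ a² + d²` iff `γ < 2`). With
`β = γ₀` and a band `[γ₀, γ₁]` the defect is `(g - γ₀ω)(-2d² + γ₀ad) ≤ (g - γ₀ω)γ₀²a²/8`
(complete the square), whence the angle-rate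

  `λ* = γ₀ - γ₀²(γ₁ - γ₀)/(8(1 - γ₀/2))`   (`= γ₀` at `γ₁ = γ₀`; `= 3/4` for the band `[1, 2]`).

* `DampedRotor.lyapunov_alg_sharp` — the algebraic identity-plus-square behind it;
* `DampedRotor.energy_decay_time_sharp` — for `0 < γ₀ < 2`, `γ₀ ≤ γ₁`, any `0 ≤ λ ≤ λ*`,
  `|a|, |d| ≤ R`, `Θ ≤ ΘM`, forcing `δ`:
  `(1 - γ₀/2)(a(t)² + d(t)²) ≤ exp(-λΘ(t))·((1 + γ₀/2)(a(0)² + d(0)²) + 8Rδ·exp(λΘM)·t)`.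

Calibration: band `[1, 2]`, `λ = 3/4`: 80 % conversion of the pair energy needs
`3·exp(-0.75·Θ) ≤ 0.2`, i.e. `Θ ≥ 3.6 rad` — the observed completion angles are `1.9–4.5 rad`.
[cite: Tao2016AveragedNS, §5.5 (the energy-transfer phase of Thm 5.3)]
-/

noncomputable section

open Set Real

namespace Literature.Analysis.FluidPDE.FluidComputer

open Literature.Analysis.ODE

namespace DampedRotor

/-- The sharp algebraic step: for `γ₀ω ≤ g ≤ γ₁ω` (no sign conditions are needed),
`-2g·d² + γ₀ω·d² - γ₀ω·a² + γ₀g·(ad) ≤ -γ₀ω·(a² + d² - γ₀·ad) + ((γ₁ - γ₀)γ₀²/8)·ω·a²`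
(equality in the first term at `g = γ₀ω`; the defect is `(g - γ₀ω)(-2d² + γ₀ad)` and
`-2d² + γ₀ad = -2(d - γ₀a/4)² + γ₀²a²/8`). [folklore] -/
theorem lyapunov_alg_sharp {γ₀ γ₁ ω g a d : ℝ} (hg : γ₀ * ω ≤ g) (hg₁ : g ≤ γ₁ * ω) :
    -2 * g * d ^ 2 + γ₀ * ω * d ^ 2 - γ₀ * ω * a ^ 2 + γ₀ * g * (a * d) ≤
      -(γ₀ * ω * (a ^ 2 + d ^ 2 - γ₀ * (a * d))) + (γ₁ - γ₀) * γ₀ ^ 2 / 8 * ω * a ^ 2 := by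
  have he : 0 ≤ g - γ₀ * ω := by linarith
  have he1 : g - γ₀ * ω ≤ (γ₁ - γ₀) * ω := by linarith
  have hid : -2 * g * d ^ 2 + γ₀ * ω * d ^ 2 - γ₀ * ω * a ^ 2 + γ₀ * g * (a * d) +
      γ₀ * ω * (a ^ 2 + d ^ 2 - γ₀ * (a * d)) =
      (g - γ₀ * ω) * (-2 * d ^ 2 + γ₀ * (a * d)) := by ring
  have hsq : -2 * d ^ 2 + γ₀ * (a * d) ≤ γ₀ ^ 2 * a ^ 2 / 8 := by
    nlinarith [sq_nonneg (d - γ₀ * a / 4)]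
  have h1 : (g - γ₀ * ω) * (-2 * d ^ 2 + γ₀ * (a * d)) ≤ (g - γ₀ * ω) * (γ₀ ^ 2 * a ^ 2 / 8) :=
    mul_le_mul_of_nonneg_left hsq he
  have h2 : (g - γ₀ * ω) * (γ₀ ^ 2 * a ^ 2 / 8) ≤ (γ₁ - γ₀) * ω * (γ₀ ^ 2 * a ^ 2 / 8) :=
    mul_le_mul_of_nonneg_right he1 (by positivity)
  nlinarith [hid, h1, h2]

variable {a d a' d' ω g Θ : ℝ → ℝ} {γ₀ γ₁ lam R δ ΘM T : ℝ}

/-- **Sharp pair-energy decay in time, weighted by the angle.** See the module docstring: for any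
`0 ≤ λ ≤ λ* = γ₀ - γ₀²(γ₁ - γ₀)/(8(1 - γ₀/2))`,
`(1 - γ₀/2)(a(t)² + d(t)²) ≤ exp(-λΘ(t))·((1 + γ₀/2)(a(0)² + d(0)²) + 8Rδ·exp(λΘM)·t)`.
[folklore] -/
theorem energy_decay_time_sharp (hac : ContinuousOn a (Icc 0 T)) (hdc : ContinuousOn d (Icc 0 T))
    (ha' : ∀ s ∈ Ico 0 T, HasDerivWithinAt a (a' s) (Ici s) s)
    (hd' : ∀ s ∈ Ico 0 T, HasDerivWithinAt d (d' s) (Ici s) s)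
    (hΘc : ContinuousOn Θ (Icc 0 T)) (hΘ0 : Θ 0 = 0)
    (hΘ' : ∀ s ∈ Ico 0 T, HasDerivWithinAt Θ (ω s) (Ici s) s) (hΘM : ∀ s ∈ Icc 0 T, Θ s ≤ ΘM)
    (hω : ∀ s ∈ Ico 0 T, 0 ≤ ω s) (hγ₀ : 0 < γ₀) (hγ₂ : γ₀ < 2) (hγ₁ : γ₀ ≤ γ₁)
    (hlam0 : 0 ≤ lam) (hlam : lam ≤ γ₀ - γ₀ ^ 2 * (γ₁ - γ₀) / (8 * (1 - γ₀ / 2)))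
    (hg : ∀ s ∈ Ico 0 T, γ₀ * ω s ≤ g s ∧ g s ≤ γ₁ * ω s) (hR : 0 ≤ R) (hδ : 0 ≤ δ)
    (hab : ∀ s ∈ Ico 0 T, |a s| ≤ R ∧ |d s| ≤ R)
    (hp : ∀ s ∈ Ico 0 T, |a' s + ω s * d s| ≤ δ)
    (hq : ∀ s ∈ Ico 0 T, |d' s - (ω s * a s - g s * d s)| ≤ δ) :
    ∀ t ∈ Icc 0 T, (1 - γ₀ / 2) * (a t ^ 2 + d t ^ 2) ≤
      exp (-lam * Θ t) * ((1 + γ₀ / 2) * (a 0 ^ 2 + d 0 ^ 2) + 8 * R * δ * exp (lam * ΘM) * t) := by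
  intro t ht
  have hm : 0 < 1 - γ₀ / 2 := by linarith
  have hRδ : 0 ≤ R * δ := mul_nonneg hR hδ
  -- Lyapunov function `V = a² + d² - γ₀ ad`
  set V : ℝ → ℝ := fun s => a s * a s + d s * d s - γ₀ * (a s * d s) with hV_def
  set V' : ℝ → ℝ := fun s => (a' s * a s + a s * a' s) + (d' s * d s + d s * d' s) -
    γ₀ * (a' s * d s + a s * d' s) with hV'_def
  have hVc : ContinuousOn V (Icc 0 T) :=
    ((hac.mul hac).add (hdc.mul hdc)).sub (continuousOn_const.mul (hac.mul hdc))
  have hVd : ∀ s ∈ Ico 0 T, HasDerivWithinAt V (V' s) (Ici s) s := fun s hs =>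
    (((ha' s hs).mul (ha' s hs)).add ((hd' s hs).mul (hd' s hs))).sub
      (((ha' s hs).mul (hd' s hs)).const_mul γ₀)
  have hsand : ∀ s, (1 - γ₀ / 2) * (a s ^ 2 + d s ^ 2) ≤ V s ∧
      V s ≤ (1 + γ₀ / 2) * (a s ^ 2 + d s ^ 2) := by
    intro s
    have h1 : a s * d s ≤ (a s ^ 2 + d s ^ 2) / 2 := by nlinarith [sq_nonneg (a s - d s)]
    have h2 : -(a s * d s) ≤ (a s ^ 2 + d s ^ 2) / 2 := by nlinarith [sq_nonneg (a s + d s)]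
    have h3 := mul_le_mul_of_nonneg_left h1 hγ₀.le
    have h4 := mul_le_mul_of_nonneg_left h2 hγ₀.le
    have hV : V s = a s ^ 2 + d s ^ 2 - γ₀ * (a s * d s) := by simp only [hV_def]; ring
    constructor <;> linarith [hV, h3, h4]
  -- `V' + lam ω V ≤ 8Rδ`
  have hineq : ∀ s ∈ Ico 0 T, V' s + lam * ω s * V s ≤ 8 * R * δ := by
    intro s hs
    obtain ⟨hgs0, hgs1⟩ := hg s hs
    obtain ⟨haR, hdR⟩ := hab s hs
    have hωs := hω s hs
    set p := a' s + ω s * d s with hp_def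
    set q := d' s - (ω s * a s - g s * d s) with hq_def
    have hpδ : |p| ≤ δ := hp s hs
    have hqδ : |q| ≤ δ := hq s hs
    have ea : a' s = -(ω s * d s) + p := by simp only [hp_def]; ring
    have ed : d' s = ω s * a s - g s * d s + q := by simp only [hq_def]; ring
    have halg := lyapunov_alg_sharp (a := a s) (d := d s) hgs0 hgs1
    have hf1 : a s * p ≤ R * δ := by
      have h := le_abs_self (a s * p); rw [abs_mul] at h
      exact h.trans (mul_le_mul haR hpδ (abs_nonneg p) hR)
    have hf2 : d s * q ≤ R * δ := by
      have h := le_abs_self (d s * q); rw [abs_mul] at h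
      exact h.trans (mul_le_mul hdR hqδ (abs_nonneg q) hR)
    have hf3 : -(p * d s) ≤ R * δ := by
      have h := neg_le_abs (p * d s); rw [abs_mul] at h
      have h2 : |p| * |d s| ≤ δ * R := mul_le_mul hpδ hdR (abs_nonneg _) hδ
      linarith
    have hf4 : -(a s * q) ≤ R * δ := by
      have h := neg_le_abs (a s * q); rw [abs_mul] at h
      exact h.trans (mul_le_mul haR hqδ (abs_nonneg q) hR)
    have hf3' := mul_le_mul_of_nonneg_left hf3 hγ₀.le
    have hf4' := mul_le_mul_of_nonneg_left hf4 hγ₀.le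
    have hγRδ : γ₀ * (R * δ) ≤ 2 * (R * δ) := mul_le_mul_of_nonneg_right hγ₂.le hRδ
    -- `a² ≤ u ≤ V/m`
    have hVs : V s = a s ^ 2 + d s ^ 2 - γ₀ * (a s * d s) := by simp only [hV_def]; ring
    have hlo := (hsand s).1
    have ha2V : (1 - γ₀ / 2) * a s ^ 2 ≤ V s := by
      have : (1 - γ₀ / 2) * a s ^ 2 ≤ (1 - γ₀ / 2) * (a s ^ 2 + d s ^ 2) :=
        mul_le_mul_of_nonneg_left (by nlinarith [sq_nonneg (d s)]) hm.le
      linarith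
    have hV0 : 0 ≤ V s := le_trans (by positivity) hlo
    -- the defect term `((γ₁-γ₀)γ₀²/8) ω a² ≤ ((γ₁-γ₀)γ₀²/(8m)) ω V`
    have hc0 : 0 ≤ (γ₁ - γ₀) * γ₀ ^ 2 / 8 * ω s := by
      have : 0 ≤ γ₁ - γ₀ := by linarith
      positivity
    have hdef : (γ₁ - γ₀) * γ₀ ^ 2 / 8 * ω s * a s ^ 2 ≤
        (γ₁ - γ₀) * γ₀ ^ 2 / 8 * ω s * (V s / (1 - γ₀ / 2)) := by
      refine mul_le_mul_of_nonneg_left ?_ hc0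
      rw [le_div_iff₀ hm]; linarith
    -- `main ≤ -lam* ω V ≤ -lam ω V`
    have hstar : -(γ₀ * ω s * V s) + (γ₁ - γ₀) * γ₀ ^ 2 / 8 * ω s * (V s / (1 - γ₀ / 2)) =
        -((γ₀ - γ₀ ^ 2 * (γ₁ - γ₀) / (8 * (1 - γ₀ / 2))) * (ω s * V s)) := by
      field_simp
      ring
    have hωV : 0 ≤ ω s * V s := mul_nonneg hωs hV0
    have hmono : -((γ₀ - γ₀ ^ 2 * (γ₁ - γ₀) / (8 * (1 - γ₀ / 2))) * (ω s * V s)) ≤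
        -(lam * (ω s * V s)) := by
      have := mul_le_mul_of_nonneg_right hlam hωV
      linarith
    have hid : V' s + lam * ω s * V s =
        (-2 * g s * d s ^ 2 + γ₀ * ω s * d s ^ 2 - γ₀ * ω s * a s ^ 2 + γ₀ * g s * (a s * d s)) +
        (2 * (a s * p) + 2 * (d s * q) + γ₀ * (-(p * d s)) + γ₀ * (-(a s * q))) +
        lam * (ω s * V s) := by
      simp only [hV'_def, hVs, ea, ed]; ring
    rw [hid]
    have hmain : -2 * g s * d s ^ 2 + γ₀ * ω s * d s ^ 2 - γ₀ * ω s * a s ^ 2 +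
        γ₀ * g s * (a s * d s) ≤ -(lam * (ω s * V s)) := by
      have h1 := halg
      rw [← hVs] at h1
      linarith [h1, hdef, hstar, hmono]
    linarith [hmain, hf1, hf2, hf3', hf4', hγRδ, hRδ]
  -- `W = exp(lam Θ) V` has `W' ≤ 8Rδ exp(lam ΘM)`
  have hE : ∀ s ∈ Ico 0 T, HasDerivWithinAt (fun x => exp (lam * Θ x))
      (exp (lam * Θ s) * (lam * ω s)) (Ici s) s :=
    fun s hs => ((hΘ' s hs).const_mul lam).exp
  have hWc : ContinuousOn (fun s => exp (lam * Θ s) * V s) (Icc 0 T) :=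
    ((continuousOn_const.mul hΘc).rexp).mul hVc
  have hWd : ∀ s ∈ Ico 0 T, HasDerivWithinAt (fun x => exp (lam * Θ x) * V x)
      (exp (lam * Θ s) * (lam * ω s) * V s + exp (lam * Θ s) * V' s) (Ici s) s :=
    fun s hs => (hE s hs).mul (hVd s hs)
  set M := 8 * R * δ * exp (lam * ΘM) with hM_def
  have hbd : ∀ s ∈ Ico 0 T,
      exp (lam * Θ s) * (lam * ω s) * V s + exp (lam * Θ s) * V' s ≤ M := by
    intro s hs
    have hes : 0 < exp (lam * Θ s) := exp_pos _
    have h1 : exp (lam * Θ s) * (lam * ω s) * V s + exp (lam * Θ s) * V' s =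
        exp (lam * Θ s) * (V' s + lam * ω s * V s) := by ring
    rw [h1]
    have h2 : exp (lam * Θ s) * (V' s + lam * ω s * V s) ≤ exp (lam * Θ s) * (8 * R * δ) :=
      mul_le_mul_of_nonneg_left (hineq s hs) hes.le
    have h3 : exp (lam * Θ s) ≤ exp (lam * ΘM) :=
      exp_le_exp.2 (mul_le_mul_of_nonneg_left (hΘM s (Ico_subset_Icc_self hs)) hlam0)
    have h4 := mul_le_mul_of_nonneg_right h3 (by positivity : (0:ℝ) ≤ 8 * R * δ)
    simp only [hM_def]; linarith
  have hmain := sub_le_mul_of_deriv_right_le hWc hWd hbd t ht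
  simp only [hΘ0, mul_zero, exp_zero, one_mul, sub_zero] at hmain
  -- unwind
  have het : 0 < exp (lam * Θ t) := exp_pos _
  have hexp_neg : exp (-lam * Θ t) = (exp (lam * Θ t))⁻¹ := by
    rw [← exp_neg]; congr 1; ring
  have hM0 : 0 ≤ M := by positivity
  have hVt : V t ≤ (exp (lam * Θ t))⁻¹ * (V 0 + M * t) := by
    rw [le_inv_mul_iff₀ het]; linarith
  have hV0 := (hsand 0).2
  have hlo := (hsand t).1
  have hi0 : 0 ≤ (exp (lam * Θ t))⁻¹ := inv_nonneg.2 het.le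
  have hm' := mul_le_mul_of_nonneg_left
    (by linarith [hV0] : V 0 + M * t ≤ (1 + γ₀ / 2) * (a 0 ^ 2 + d 0 ^ 2) + M * t) hi0
  rw [hexp_neg]
  simp only [hM_def] at hm' hVt
  linarith [hlo, hVt, hm']

end DampedRotor

end Literature.Analysis.FluidPDE.FluidComputer

end
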